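import Summits.Ventures.Crystal3D.Theorems.StickyWulffConstantCoaxialWallLawInPlaneRunEndsTop
import Summits.Ventures.Crystal3D.Theorems.StickyWulffConstantCoaxialWallLawLayeredFrame
import HarnessLib

/-!
# Two-sided counts for `stub_coaxialTwoSlabAdhesion`: the top grain's located in-plane run ends per signed class

HONEST FRAMING. Part of the venture `Summits/Ventures/Crystal3D` (cell `crystal3d-full`), helper
`--supports` the crux `CoaxialWallLaw` (stmt-Ventures-19481, `route-Ventures-StickyWulffConstant`),
REGISTERED line `WallLedgerF` (planner cf-p1 gen 16), open stub `stub_coaxialTwoSlabAdhesion`.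
RUNG CREDIT ONLY; F-C1 not moved.  Companion of `…CoaxialWallLawLayered.card_inPlane_runEnds_ge_coaxial` for
the TOP grain: the rows of `Λ₂` rooted in the top sample end at the risers too, so the layered / off-site laws
can charge BOTH grains (`…CoaxialWallLawTwoSided`: constant `2√6/3` instead of `√6/3`).

* `card_inPlane_runEnds_top_ge_coaxial` — for the crux's frame data and a slot `u` of grain 2 with
  `⟪A₂ u, e₃⟫ ≤ 0`, `A₂ u = L(ε v)` a signed in-plane class: located ends of grain 2 along `A₂ u`
  `≥ (2/3)√2|⟪A₂ u, e₃⟫|πρ² − (12√2π + 72R₀)ρ` (disjointness / the layer shift of grain 2, `…LayeredFrame`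
  with the grains swapped; `…InPlaneRunEndsTop`).
* `exists_slot_top_of_inPlane_class` — every signed in-plane class `L(ε v)` is a slot vector of grain 2.

WHAT THIS IS NOT: no deficiency; F-C1 not moved.
-/

noncomputable section

namespace Summit.Ventures.Crystal3D.Theorems

open Summit.Ventures.Crystal3D Finset
open Literature.MathematicalPhysics.StatisticalMechanics (fccStacking barlowStacking IsHaggSeq
  triangularVec₁ triangularVec₂ barlowOffset layerNormal)
open scoped InnerProductSpace

/-- **Every signed in-plane class is a slot vector of the grain** (both signs). -/
theorem exists_slot_top_of_inPlane_class
    (A : EuclideanSpace ℝ (Fin 3) ≃ₗᵢ[ℝ] EuclideanSpace ℝ (Fin 3)) (t : EuclideanSpace ℝ (Fin 3))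
    (L : EuclideanSpace ℝ (Fin 3) ≃ₗᵢ[ℝ] EuclideanSpace ℝ (Fin 3)) (s : EuclideanSpace ℝ (Fin 3))
    {σ : ℤ → ℤ} (hσ : IsHaggSeq σ)
    (hsub : (fun p => A p + t) '' fccStacking 1 (Real.sqrt (2 / 3)) ⊆
      (fun p => L p + s) '' barlowStacking 1 (Real.sqrt (2 / 3)) σ)
    (i j : ℤ) (hv : ‖(i : ℝ) • triangularVec₁ (1 : ℝ) + (j : ℝ) • triangularVec₂ 1‖ = 1)
    {ε : ℝ} (hε : ε = 1 ∨ ε = -1) :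
    ∃ w ∈ fccSlots, A w = L (ε • ((i : ℝ) • triangularVec₁ (1 : ℝ) + (j : ℝ) • triangularVec₂ 1)) := by
  obtain ⟨ε', hε', w, hw, hAw, -⟩ := exists_up_slot_of_inPlane_class A t L s hσ hsub i j hv
  by_cases heq : ε' = ε
  · exact ⟨w, hw, by rw [hAw, heq]⟩
  · have hneg : ε = -ε' := by
      rcases hε with rfl | rfl <;> rcases hε' with rfl | rfl <;> first | exact absurd rfl heq | norm_num
    refine ⟨-w, neg_mem_fccSlots hw, ?_⟩
    rw [map_neg, hAw, hneg, neg_smul, map_neg]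

open scoped Classical in
/-- **Located in-plane run ends of the TOP grain along a signed in-plane class, co-axial pair** (translation
pairs via disjointness, twin pairs via the layer shift of grain 2; unified linear loss). -/
theorem card_inPlane_runEnds_top_ge_coaxial
    (A₁ : EuclideanSpace ℝ (Fin 3) ≃ₗᵢ[ℝ] EuclideanSpace ℝ (Fin 3)) (t₁ : EuclideanSpace ℝ (Fin 3))
    (A₂ : EuclideanSpace ℝ (Fin 3) ≃ₗᵢ[ℝ] EuclideanSpace ℝ (Fin 3)) (t₂ : EuclideanSpace ℝ (Fin 3))
    (L : EuclideanSpace ℝ (Fin 3) ≃ₗᵢ[ℝ] EuclideanSpace ℝ (Fin 3)) (s₁ s₂ : EuclideanSpace ℝ (Fin 3))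
    {σ σ' : ℤ → ℤ} (hσ : IsHaggSeq σ) (hσ' : IsHaggSeq σ')
    (hsub₁ : (fun p => A₁ p + t₁) '' fccStacking 1 (Real.sqrt (2 / 3)) ⊆
      (fun p => L p + s₁) '' barlowStacking 1 (Real.sqrt (2 / 3)) σ)
    (hsub₂ : (fun p => A₂ p + t₂) '' fccStacking 1 (Real.sqrt (2 / 3)) ⊆
      (fun p => L p + s₂) '' barlowStacking 1 (Real.sqrt (2 / 3)) σ')
    (hne : (fun p => A₁ p + t₁) '' fccStacking 1 (Real.sqrt (2 / 3)) ≠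
      (fun p => A₂ p + t₂) '' fccStacking 1 (Real.sqrt (2 / 3)))
    (X P₁ P₂ : Finset (EuclideanSpace ℝ (Fin 3))) (R₀ h ρ : ℝ) (hR₀ : 10 ≤ R₀) (hρ : R₀ ≤ ρ)
    (hX : ∀ p ∈ X, ∀ q ∈ X, p ≠ q → 1 ≤ dist p q)
    (hcell : ∀ p ∈ X, -(2 * R₀) ≤ p 2 ∧ p 2 ≤ h + 2 * R₀ ∧ p 0 ^ 2 + p 1 ^ 2 ≤ ρ ^ 2)
    (hP₁X : P₁ ⊆ X) (hP₂X : P₂ ⊆ X)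
    (hP₁ : ∀ p, p ∈ P₁ ↔ (p ∈ (fun q => A₁ q + t₁) '' fccStacking 1 (Real.sqrt (2 / 3)) ∧
      -(2 * R₀) ≤ p 2 ∧ p 2 ≤ -R₀ ∧ p 0 ^ 2 + p 1 ^ 2 ≤ ρ ^ 2))
    (hP₂ : ∀ p, p ∈ P₂ ↔ (p ∈ (fun q => A₂ q + t₂) '' fccStacking 1 (Real.sqrt (2 / 3)) ∧
      h + R₀ ≤ p 2 ∧ p 2 ≤ h + 2 * R₀ ∧ p 0 ^ 2 + p 1 ^ 2 ≤ ρ ^ 2))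
    {u : EuclideanSpace ℝ (Fin 3)} (hu : u ∈ fccSlots)
    (hdown : ⟪A₂ u, EuclideanSpace.single (2 : Fin 3) (1 : ℝ)⟫_ℝ ≤ 0)
    {ε : ℝ} (hε : ε = 1 ∨ ε = -1) (i j : ℤ)
    (hAu : A₂ u = L (ε • ((i : ℝ) • triangularVec₁ (1 : ℝ) + (j : ℝ) • triangularVec₂ 1))) :
    2 / 3 * Real.sqrt 2 * |⟪A₂ u, EuclideanSpace.single (2 : Fin 3) (1 : ℝ)⟫_ℝ| * Real.pi * ρ ^ 2 -
        (12 * Real.sqrt 2 * Real.pi + 72 * R₀) * ρ ≤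
      ((X.filter fun e => e ∈ (fun q => A₂ q + t₂) '' fccStacking 1 (Real.sqrt (2 / 3)) ∧
        e ∉ (fun q => A₁ q + t₁) '' fccStacking 1 (Real.sqrt (2 / 3)) ∧
        e + A₂ u ∉ X ∧ -R₀ - 2 ≤ e 2 ∧ e 2 ≤ h + R₀ + 2).card : ℝ) := by
  set Λ₁ := (fun q => A₁ q + t₁) '' fccStacking 1 (Real.sqrt (2 / 3)) with hΛ₁
  have hρ0 : (0 : ℝ) ≤ ρ := by linarith
  set a : ℝ := |⟪A₂ u, EuclideanSpace.single (2 : Fin 3) (1 : ℝ)⟫_ℝ| with ha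
  have ha0 : 0 ≤ a := abs_nonneg _
  have ha1 : a ≤ 1 := abs_inner_slot_le_one A₂ hu
  set M : ℝ := Real.sqrt 2 * Real.pi with hM
  have hM0 : 0 ≤ M := by positivity
  -- `Λ₁` is invariant under `± A₂ u`
  have hper : ∀ x ∈ Λ₁, ∀ a b : ℤ, x + L ((a : ℝ) • triangularVec₁ (1 : ℝ) + (b : ℝ) • triangularVec₂ 1) ∈ Λ₁ :=
    fun x hx a b => coaxial_inPlane_slot_mem A₁ t₁ L s₁ hσ hsub₁ hx a b
  have hinv₁ : ∀ x, x ∈ Λ₁ → x + A₂ u ∈ Λ₁ ∧ x - A₂ u ∈ Λ₁ := by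
    intro x hx
    rcases hε with rfl | rfl
    · rw [one_smul] at hAu
      refine ⟨by rw [hAu]; exact hper x hx i j, ?_⟩
      have e : x - A₂ u = x + L ((((-i : ℤ)) : ℝ) • triangularVec₁ (1 : ℝ) + (((-j : ℤ)) : ℝ) • triangularVec₂ 1) := by
        rw [hAu, sub_eq_add_neg, ← map_neg]
        congr 2
        push_cast
        module
      rw [e]; exact hper x hx (-i) (-j)
    · rw [neg_one_smul, map_neg] at hAu
      refine ⟨?_, by rw [hAu, sub_neg_eq_add]; exact hper x hx i j⟩
      have e : x + A₂ u = x + L ((((-i : ℤ)) : ℝ) • triangularVec₁ (1 : ℝ) + (((-j : ℤ)) : ℝ) • triangularVec₂ 1) := by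
        rw [hAu, ← map_neg]
        congr 2
        push_cast
        module
      rw [e]; exact hper x hx (-i) (-j)
  by_cases hsame : σ 0 = σ' 0
  · -- translation pair: disjoint grains, full flux
    have hdisj := coaxial_disjoint_of_sameWord A₂ t₂ A₁ t₁ L s₂ s₁ hσ' hσ hsub₂ hsub₁ (Eq.symm hsame) hne.symm
    have h := card_inPlane_runEnds_top_ge_of_disjoint A₁ t₁ A₂ t₂ X P₁ P₂ R₀ h ρ (by linarith) hρ hX hcell
      hP₁X hP₂X hP₁ hP₂ hdisj hu hdown hinv₁
    have hkey : 2 / 3 * Real.sqrt 2 * a * Real.pi * ρ ^ 2 - (12 * Real.sqrt 2 * Real.pi + 72 * R₀) * ρ ≤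
        Real.sqrt 2 * a * Real.pi * (ρ - 1) ^ 2 - 10 * Real.sqrt 2 * Real.pi * (ρ - 1) - 72 * R₀ * ρ := by
      have e1 : Real.sqrt 2 * a * Real.pi * (ρ - 1) ^ 2 - 10 * Real.sqrt 2 * Real.pi * (ρ - 1) - 72 * R₀ * ρ -
          (2 / 3 * Real.sqrt 2 * a * Real.pi * ρ ^ 2 - (12 * Real.sqrt 2 * Real.pi + 72 * R₀) * ρ) =
          M * a * (1 / 3 * ρ ^ 2 - 2 * ρ + 1) + 2 * M * ρ + 10 * M := by rw [hM]; ring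
      have h1 : 0 ≤ 1 / 3 * ρ ^ 2 - 2 * ρ + 1 := by nlinarith
      have h2 : 0 ≤ M * a * (1 / 3 * ρ ^ 2 - 2 * ρ + 1) := by positivity
      nlinarith [mul_nonneg hM0 hρ0]
    exact hkey.trans h
  · -- twin pair: the layer shift of grain 2, two thirds of the flux
    obtain ⟨hg1, hgΛ₂, hgΛ₁⟩ := coaxial_layerShift A₂ t₂ A₁ t₁ L s₂ s₁ hσ' hσ hsub₂ hsub₁
    have h := card_inPlane_runEnds_top_ge_of_shift A₁ t₁ A₂ t₂ X P₁ P₂ R₀ h ρ (by linarith) hρ hX hcell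
      hP₁X hP₂X hP₁ hP₂ hg1 hgΛ₂ (hgΛ₁ fun h' => hsame h'.symm) hu hdown hinv₁
    have hkey : 2 / 3 * Real.sqrt 2 * a * Real.pi * ρ ^ 2 - (12 * Real.sqrt 2 * Real.pi + 72 * R₀) * ρ ≤
        2 / 3 * (Real.sqrt 2 * a * Real.pi * (ρ - 2) ^ 2 - 10 * Real.sqrt 2 * Real.pi * (ρ - 2)) - 72 * R₀ * ρ := by
      have e1 : 2 / 3 * (Real.sqrt 2 * a * Real.pi * (ρ - 2) ^ 2 - 10 * Real.sqrt 2 * Real.pi * (ρ - 2)) -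
          72 * R₀ * ρ - (2 / 3 * Real.sqrt 2 * a * Real.pi * ρ ^ 2 - (12 * Real.sqrt 2 * Real.pi + 72 * R₀) * ρ) =
          8 / 3 * M * (1 - a) * ρ + 8 / 3 * M * a + 8 / 3 * M * ρ + 40 / 3 * M := by rw [hM]; ring
      have h1 : 0 ≤ 1 - a := by linarith
      have h2 : 0 ≤ 8 / 3 * M * (1 - a) * ρ := by positivity
      nlinarith [mul_nonneg hM0 hρ0, mul_nonneg hM0 ha0]
    exact hkey.trans h


end Summit.Ventures.Crystal3D.Theorems

end
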